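import Literature.NumberTheory.EllipticCurves.Kato2004.EllipticZetaReciprocity
import Literature.NumberTheory.EllipticCurves.Kato2004.IwasawaCohomologyNumberFieldRestriction
import Literature.NumberTheory.EllipticCurves.ZpExtensionRestrict
import Literature.NumberTheory.EllipticCurves.CyclotomicZpExtension
import Literature.NumberTheory.GaloisRepresentations.LocalKroneckerWeberInertiaProofs
import Literature.NumberTheory.EllipticCurves.WeilPairingProofs
import Literature.NumberTheory.EllipticCurves.TorsionCardinality
import HarnessLib

set_option autoImplicit false

/-!
# `𝒞₇` genus road (crux `EllipticUnitValueSevenOfGZK`, K7r), row (K2C-3) block (N2): the number-field remainder of the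
# pinned frame — the field `isRayClassLayer_layer` («`Kℚ_n ⊂ K(ζ_{7^{n+1}}) ⊂ K(W[7^{n+1}])`») PROVED, hypothesis-free,
# from the tree's Weil pairing; and the (N2)(a) finding on `bad_iff_dvd`

Cell bsd-cm, seat bsd-cm-prr-ty1 g31 (literature-prover), SUMMON `wake/SUMMON-bsd-cm-prr-ty1-20260830T1838Z.md` (planner
bsd-cm-plan g36, D927; key K2C-3), block (N2) («a NEW file `…NumberFieldColumnTwo.lean` (never edit (N))»).  HONEST LABEL:
THEOREMS ONLY — no `def`, no named fact, no typed hypothesis, no instance, no notation, no `sorry`.  The SUMMON budgeted ONE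
typed hypothesis `WeilContainment` («`μ_{7^{n+1}} ⊂ K(W[7^{n+1}])`, no fact»); it is NOT needed: the tree CONSTRUCTS the Weil
pairing (`WeierstrassCurve.exists_weilPairing_holds`, file `WeilPairingProofs`, *AEC* III.8.1 (a)–(d), every level `m ≥ 2`
invertible in a perfect field) and counts `#V[m] = m²` (`WeierstrassCurve.card_torsionBy_eq_sq`, `TorsionCardinality`), so the
containment is PROVED here (§3) and the frame field `isRayClassLayer_layer` of `PinnedKatoGenusFrame` ((P1) p776025,
l.202–203) is inhabited for EVERY number field `K` of degree `2`, every cyclotomic `ℤ₇`-datum `κ` of `ℚ`, every elliptic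
`V/K`, every `d` (§4) — modulo nothing.  stmt-BirchSwinnertonDyer-19945 is OPEN; `X12.CMRamifiedSeven` NOT proved; no summit
statement is proved by this seat; BSD is claimed for no curve.

## What is proved (numbers, not adjectives)

* §1 `exists_units_pow_eq_of_dvd_sub_one` — for `p ≥ 3`, `p^{n+1} ∣ u − 1` ⇒ `u = c^{p^n}` for a unit `c` (`u = (1+p)^x` with
  `‖x‖·‖p‖ = ‖u − 1‖ ≤ ‖p^n‖·‖p‖`, tree `PadicOneUnits.exists_oneAddPow_eq` / `norm_oneAddPow_sub_one`, so `x = p^n y`,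
  `c = (1+p)^y`; Serre, *Cours d'arithmétique* II §3.2 Prop. 8).
* §2 THE TOWER BOOKKEEPING (Washington §13.1): `mem_layerSubgroup_of_dvd_cyclotomicCharacter_sub_one` — for ANY cyclotomic
  `ℤ_p`-datum `κ` of `ℚ` (`ker κ = χ_p⁻¹(μ(ℤ_p))`, `ZpExtension.IsCyclotomic`), `p ≥ 3`, and `σ ∈ Γ_ℚ` with
  `χ_p(σ) ≡ 1 (mod p^{n+1})`: `σ ∈ κ.layerSubgroup n` (= `Gal(ℚ̄/ℚ_n)`), i.e. `ℚ_n ⊂ ℚ(μ_{p^{n+1}})` — `χ_p(σ) = c^{p^n}`,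
  `c = χ_p(τ)` (`GaloisRep.cyclotomicCharacter_rat_surjective`), `σ·(τ^{p^n})⁻¹ ∈ ker κ`, so `κ σ = p^n κ τ`; and its
  transfer `mem_layerSubgroup_restrict_of_dvd_cyclotomicCharacter_sub_one` to `κ.restrict K h` over any number field `K`
  (`cyclotomicCharacter_absGaloisRestrict`, `mem_layerSubgroup_restrict_iff`).
* §3 THE WEIL-PAIRING CONTAINMENT (Silverman III Cor. 8.1.1): `torsionLayer_le_of_dvd` (`V[m] ⊆ V[m']` for `m ∣ m'`);
  `exists_weilPairing_isPrimitiveRoot` — for `V` elliptic in characteristic `0` and `m ≥ 2`, the tree's Weil pairing is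
  Galois-equivariant and takes a PRIMITIVE `m`-th root of unity as a value `e(S₀, T₁)` (the printed proof: exponent of `V[m]`
  is `m` by `#V[m] = m²`, cyclic image of `T ↦ e(S₀, T)`, non-degeneracy; the tree runs it only under `V[m] ⊂ V(L)` inside
  `exists_isPrimitiveRoot_of_card_torsionBy_eq_sq_of_exists_weilPairing`, here without); ★
  `dvd_cyclotomicCharacter_sub_one_of_mem_torsionLayer` — `σ ∈ Gal(L̄/L(V[p^{n+1}]))` (`CM.torsionLayer V (p^(n+1))`) ⇒
  `p^{n+1} ∣ χ_p(σ) − 1`, i.e. `μ_{p^{n+1}} ⊂ L(V[p^{n+1}])` (`σ ζ = e(σ S₀, σ T₁) = ζ` against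
  `σ ζ = ζ^{χ_p(σ) mod p^{n+1}}`, `GaloisRep.cyclotomicCharacter_spec`).
* §4 ★ `isRayClassLayer_layer` — for `[K:ℚ] = 2`, `κ` cyclotomic over `ℚ`, `V/K` elliptic, any `d n : ℕ`:
  `CM.IsRayClassLayer V 7 (7 * d) ((κ.restrictOfFinrankEqTwo _ K _).layerSubgroup n)` — open (`ZpExtension.isOpen_layerSubgroup`)
  and `torsionLayer V (7^n·(7d)) ≤ torsionLayer V (7^{n+1}) ≤ layerSubgroup n` by §3 + §2; `isRayClassLayer_layer_baseChange` —
  at `V = W.baseChange K` for `W/ℚ` elliptic, `∀ n`, the frame field VERBATIM (`K = Φ.Kcm`, `κ = K`, `d = F.d`).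

## The (N2)(a) finding on `bad_iff_dvd` (reported, NOT typed here)

`bad_iff_dvd : ∀ q prime, q ≠ 7 → (¬ Good W q ↔ q ∣ F.d)` is inhabited by CHOOSING `F.D :=` the genus discriminant of the member;
for `W ∈ 𝒞₇` (`HasCM`, `cmFieldDiscrOfJ W.j = −7`, analytic rank `1`, `GoodOrd W 2`, bad `q ≠ 7` split) the four `GenusFrame`
conditions on that `D` cost: `Squarefree D`, `7 ∤ D` — free by the choice of representative (`W ≅ E₀^{(d)}`, `d` squarefree,
tree `exists_variableChange_eq_quadraticTwist_intCast_of_j_eq`, and `E₀ ↦ E₀^{(−7)}` absorbs a factor `7`, tree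
`isIsogenous_cm7_quadraticTwist`); `D ≡ 1 (mod 4)` ⟸ `GoodOrd W 2` (twists at `2`: tree
`not_hasGoodReductionAtPrime_two_of_smul_eq_quadraticTwist`-type lemmas; size M); `D < 0` ⟸ analytic rank ODD — ROOT-NUMBER content
(`w(E₀^{(D)}) = χ_D(−1)·w(E₀)` for `gcd(D, 7) = 1`, `w(49a1) = +1`, parity of `ord_{s=1}` = sign of the functional equation; size L,
not attempted); `bad_iff_dvd` itself ⟸ reduction of twists at `q ∤ 14` (tree `hasGoodReductionAt_quadraticTwist_iff_of_isSquare`; M).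
So `X12.ClassCSeven W` implies all of them on paper, none is cheap in the tree; nothing is asserted here.

## References
J. H. Silverman, *AEC* (2009) III §6 Cor. 6.4 (b), III §8 Prop. 8.1, Cor. 8.1.1 (Weil pairing; `μ_m ⊂ K(E[m])`) [SilvermanAEC2009];
L. Washington, *Cyclotomic Fields* (1997) §13.1 (`ℚ_n ⊂ ℚ(μ_{p^{n+1}})`, `K·ℚ_∞`) [Washington1997]; J.-P. Serre, *A Course in
Arithmetic* (1973) II §3.2 Prop. 8 [Serre1973]; K. Kato, Astérisque 295 (2004) §15.1 (p. 250), §15.3 (15.3.1)–(15.3.3) (p. 252),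
Prop. 15.9 (p. 258) [Kato2004Asterisque]; (P1) p776025, (N) p782382.
-/

noncomputable section

open scoped NumberField
open Field NumberField
open Literature.NumberTheory.GaloisRepresentations
open Literature.NumberTheory.EllipticCurves
open Literature.NumberTheory.EllipticCurves.Kato2004
open Literature.NumberTheory.EllipticCurves.PadicOneUnits

namespace Summit.BirchSwinnertonDyer.Rank1Residual.Additive.GenusSeven

namespace NumberFieldColumn

/-! ## §1 `u ≡ 1 (mod p^{n+1}) ⇒ u ∈ (ℤ_pˣ)^{p^n}` for odd `p` -/

section Units

variable {p : ℕ} [Fact p.Prime]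

/-- **`1 + p^{n+1}ℤ_p ⊆ (ℤ_pˣ)^{p^n}` for `p ≥ 3`**: if `p^{n+1} ∣ u − 1` then `u = c^{p^n}` for a unit `c` (`u = (1+p)^x`,
`‖x‖·‖p‖ = ‖u − 1‖ ≤ ‖p^n‖·‖p‖`, so `x = p^n·y` and `c = (1+p)^y`). [cite: Serre1973, Ch. II §3.2 Prop. 8] -/
theorem exists_units_pow_eq_of_dvd_sub_one (hp : 3 ≤ p) (n : ℕ) {u : ℤ_[p]}
    (hu : (p : ℤ_[p]) ^ (n + 1) ∣ u - 1) : ∃ c : ℤ_[p]ˣ, ((c : ℤ_[p])) ^ p ^ n = u := by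
  have he : 0 + 3 ≤ p * (0 + 1) := by omega
  have hp0 : (p : ℤ_[p]) ≠ 0 := by exact_mod_cast (Fact.out : p.Prime).ne_zero
  have hn : ‖u - 1‖ ≤ ‖(p : ℤ_[p]) ^ (n + 1)‖ := norm_le_of_dvd hu
  have h1 : ‖u - 1‖ ≤ ‖(p : ℤ_[p]) ^ (0 + 1)‖ :=
    hn.trans (norm_le_of_dvd (by rw [zero_add, pow_one]; exact dvd_pow_self _ (by omega)))
  obtain ⟨x, hx⟩ := exists_oneAddPow_eq 0 he h1
  have hnx : ‖x‖ * ‖(p : ℤ_[p]) ^ (0 + 1)‖ = ‖u - 1‖ := by rw [← hx]; exact (norm_oneAddPow_sub_one 0 he x).symm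
  have hxle : ‖x‖ ≤ ‖(p : ℤ_[p]) ^ n‖ := by
    have hpos : 0 < ‖(p : ℤ_[p]) ^ (0 + 1)‖ := norm_pos_iff.mpr (pow_ne_zero _ hp0)
    have h : ‖x‖ * ‖(p : ℤ_[p]) ^ (0 + 1)‖ ≤ ‖(p : ℤ_[p]) ^ n‖ * ‖(p : ℤ_[p]) ^ (0 + 1)‖ := by
      rw [hnx, ← norm_mul, ← pow_add]
      exact hn
    exact le_of_mul_le_mul_right h hpos
  obtain ⟨y, rfl⟩ := dvd_of_norm_le (pow_ne_zero _ hp0) hxle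
  refine ⟨(PadicInt.isUnit_iff.mpr (norm_oneAddPow 0 y)).unit, ?_⟩
  rw [IsUnit.unit_spec, ← AddChar.map_nsmul_eq_pow, ← hx, nsmul_eq_mul, Nat.cast_pow]

end Units

/-! ## §2 Tower bookkeeping: `χ_p(σ) ≡ 1 (mod p^{n+1}) ⇒ σ ∈ Gal(ℚ̄/ℚ_n)` for the cyclotomic `ℤ_p`-datum, and over `K` -/

section Tower

variable {p : ℕ} [Fact p.Prime]

/-- **`ℚ_n ⊂ ℚ(μ_{p^{n+1}})` in Galois form**: for a cyclotomic `ℤ_p`-datum `κ` of `ℚ` (`ker κ = χ_p⁻¹(μ(ℤ_p))`), `p ≥ 3`,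
and `σ ∈ Γ_ℚ` with `χ_p(σ) ≡ 1 (mod p^{n+1})`, `σ ∈ κ⁻¹(p^n ℤ_p) = Gal(ℚ̄/ℚ_n)`: write `χ_p(σ) = c^{p^n}` (§1) and `c = χ_p(τ)`
(`cyclotomicCharacter_rat_surjective`); then `χ_p(σ·(τ^{p^n})⁻¹) = 1 ∈ μ(ℤ_p)`, so `σ·(τ^{p^n})⁻¹ ∈ ker κ` and `κ σ = p^n·κ τ`.
[cite: Washington1997, §13.1] -/
theorem mem_layerSubgroup_of_dvd_cyclotomicCharacter_sub_one (κ : ZpExtension ℚ p) (hκ : κ.IsCyclotomic) (hp : 3 ≤ p)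
    (n : ℕ) (σ : absoluteGaloisGroup ℚ)
    (hσ : (p : ℤ_[p]) ^ (n + 1) ∣ ((GaloisRep.cyclotomicCharacter ℚ p σ : ℤ_[p]ˣ) : ℤ_[p]) - 1) :
    σ ∈ κ.layerSubgroup n := by
  obtain ⟨c, hc⟩ := exists_units_pow_eq_of_dvd_sub_one hp n hσ
  obtain ⟨τ, hτ⟩ := GaloisRep.cyclotomicCharacter_rat_surjective p c
  have hcu : c ^ p ^ n = GaloisRep.cyclotomicCharacter ℚ p σ := Units.ext (by rw [Units.val_pow_eq_pow_val, hc])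
  -- `σ · (τ ^ p^n)⁻¹ ∈ ker κ`
  have hker : σ * (τ ^ p ^ n)⁻¹ ∈ κ.kerSubgroup := by
    rw [hκ, Subgroup.mem_comap]
    change GaloisRep.cyclotomicCharacter ℚ p (σ * (τ ^ p ^ n)⁻¹) ∈ CommGroup.torsion ℤ_[p]ˣ
    rw [map_mul, map_inv, map_pow, hτ, hcu, mul_inv_cancel]
    exact (CommGroup.torsion ℤ_[p]ˣ).one_mem
  rw [ZpExtension.mem_kerSubgroup, map_mul, map_inv, map_pow, mul_inv_eq_one] at hker
  rw [ZpExtension.mem_layerSubgroup, hker, toAdd_pow, nsmul_eq_mul, Nat.cast_pow]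
  exact dvd_mul_right _ _

/-- **The same over a number field `K`** for the restricted datum `κ.restrict K h` (`K_n = K·ℚ_n`): `σ ∈ Γ_K` with
`χ_p(σ) ≡ 1 (mod p^{n+1})` lies in `Gal(K̄/K_n)` (`χ_{p,ℚ} ∘ res = χ_{p,K}`, `cyclotomicCharacter_absGaloisRestrict`).
[cite: Washington1997, §13.1] -/
theorem mem_layerSubgroup_restrict_of_dvd_cyclotomicCharacter_sub_one {K : Type} [Field K] [NumberField K]
    (κ : ZpExtension ℚ p) (hκ : κ.IsCyclotomic) (hp : 3 ≤ p)
    (h : Function.Surjective (κ.toContinuousMonoidHom.comp (absGaloisRestrict ℚ K))) (n : ℕ)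
    (σ : absoluteGaloisGroup K)
    (hσ : (p : ℤ_[p]) ^ (n + 1) ∣ ((GaloisRep.cyclotomicCharacter K p σ : ℤ_[p]ˣ) : ℤ_[p]) - 1) :
    σ ∈ (κ.restrict K h).layerSubgroup n := by
  haveI : NeZero (p : ℚ) := ⟨Nat.cast_ne_zero.mpr (Fact.out : p.Prime).ne_zero⟩
  rw [mem_layerSubgroup_restrict_iff]
  refine mem_layerSubgroup_of_dvd_cyclotomicCharacter_sub_one κ hκ hp n _ ?_
  rwa [cyclotomicCharacter_absGaloisRestrict ℚ K p σ]

end Tower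

/-! ## §3 The Weil-pairing containment `μ_{p^{n+1}} ⊂ L(V[p^{n+1}])`, PROVED from the tree's Weil pairing -/

section Weil

variable {L : Type} [Field L] (V : WeierstrassCurve L)

/-- **`Gal(L̄/L(V[m'])) ≤ Gal(L̄/L(V[m]))` for `m ∣ m'`** (`V[m] ⊆ V[m']`). [cite: SilvermanAEC2009, III §7] -/
theorem torsionLayer_le_of_dvd {m m' : ℕ} (h : m ∣ m') : CM.torsionLayer V m' ≤ CM.torsionLayer V m := by
  intro σ hσ
  rw [MonoidHom.mem_ker] at hσ ⊢
  -- `σ • Q = Q` for every `Q ∈ V[m']`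
  have hfix : ∀ Q : WeierstrassCurve.geomTorsion V (m' : ℤ), σ • Q = Q := fun Q ↦ by
    have h1 := DFunLike.congr_fun (congrArg Multiplicative.toAdd hσ) Q
    rwa [WeierstrassCurve.galoisRepTorsion_apply] at h1
  refine Multiplicative.toAdd.injective (AddEquiv.ext fun P ↦ ?_)
  have hP' : (P : V.geomPoints) ∈ WeierstrassCurve.geomTorsion V (m' : ℤ) := by
    obtain ⟨k, rfl⟩ := h
    have hP := (Submodule.mem_torsionBy_iff (m : ℤ) (P : V.geomPoints)).mp P.2
    rw [WeierstrassCurve.geomTorsion, AddSubgroup.torsionBy]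
    show (P : V.geomPoints) ∈ Submodule.torsionBy ℤ V.geomPoints ((m * k : ℕ) : ℤ)
    rw [Submodule.mem_torsionBy_iff, Nat.cast_mul, mul_comm, mul_smul, hP, smul_zero]
  have h1 := congrArg (fun Q : WeierstrassCurve.geomTorsion V (m' : ℤ) ↦ (Q : V.geomPoints)) (hfix ⟨P, hP'⟩)
  simp only [AddSubgroup.torsionBy.coe_smul] at h1
  rw [WeierstrassCurve.galoisRepTorsion_apply]
  exact Subtype.ext (by rw [AddSubgroup.torsionBy.coe_smul]; exact h1)

/-- **A value of the Weil pairing is a primitive `m`-th root of unity** (Silverman III Cor. 8.1.1, first clause: «there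
exist `S, T ∈ E[m]` such that `e_m(S, T)` is a primitive `m`-th root of unity»): for `V` elliptic over a field of
characteristic `0`, `m ≥ 2`, the tree's Weil pairing (`exists_weilPairing_holds`, *AEC* III.8.1 (a)–(d)) takes a primitive
`m`-th root of unity as a value.  The printed proof: `#V[m] = m²` (`card_torsionBy_eq_sq`, III.6.4 (b)) so `V[m]` has
exponent `m` and a point `S₀` of order `m`; the character `T ↦ e(S₀, T)` has cyclic image of order `d` generated by
`e(S₀, T₁)`, `e(d S₀, T) = 1` for all `T`, so `d S₀ = 0` by non-degeneracy and `m ∣ d`.  (The tree runs this argument inside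
`exists_isPrimitiveRoot_of_card_torsionBy_eq_sq_of_exists_weilPairing` under the extra hypothesis `V[m] ⊂ V(L)`; here
without it.) [cite: SilvermanAEC2009, III §8 Prop. 8.1 and Cor. 8.1.1] -/
theorem exists_weilPairing_isPrimitiveRoot [CharZero L] [V.IsElliptic] {m : ℕ} (hm : 2 ≤ m) :
    ∃ e : WeierstrassCurve.geomTorsion V m → WeierstrassCurve.geomTorsion V m → AlgebraicClosure L,
      (∀ (σ : absoluteGaloisGroup L) (S T : WeierstrassCurve.geomTorsion V m), σ • e S T = e (σ • S) (σ • T)) ∧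
      ∃ S₀ T₁ : WeierstrassCurve.geomTorsion V m, IsPrimitiveRoot (e S₀ T₁) m := by
  have hm0 : m ≠ 0 := by omega
  have hmF : (m : L) ≠ 0 := by exact_mod_cast hm0
  obtain ⟨w, hpow, haddl, haddr, halt, hnd, hgal⟩ := WeierstrassCurve.exists_weilPairing_holds V m hm hmF
  refine ⟨w, hgal, ?_⟩
  -- basic consequences of bilinearity
  have hne : ∀ S T, w S T ≠ 0 := fun S T h0 ↦ by
    have := hpow S T
    rw [h0, zero_pow hm0] at this
    exact zero_ne_one this
  have hzero_left : ∀ T, w 0 T = 1 := fun T ↦ by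
    have h := haddl 0 0 T
    rw [add_zero] at h
    exact (mul_eq_left₀ (hne 0 T)).mp h.symm
  have hnsmul_left : ∀ (a : ℕ) S T, w (a • S) T = w S T ^ a := fun a S T ↦ by
    induction a with
    | zero => rw [zero_nsmul, pow_zero, hzero_left]
    | succ a ih => rw [succ_nsmul, haddl, ih, pow_succ]
  have hswap : ∀ S T, w S T * w T S = 1 := fun S T ↦ by
    have h := halt (S + T)
    rw [haddl, haddr, haddr, halt S, halt T, one_mul, mul_one] at h
    exact h
  have hnd' : ∀ S, (∀ T, w S T = 1) → S = 0 := fun S hS ↦ hnd S fun T ↦ by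
    have h := hswap S T
    rwa [hS T, one_mul] at h
  -- `#V[n] = n²`
  have hmK : (m : AlgebraicClosure L) ≠ 0 := by exact_mod_cast hm0
  have hgeom : ∀ {n : ℕ}, (n : AlgebraicClosure L) ≠ 0 → Nat.card (WeierstrassCurve.geomTorsion V n) = n ^ 2 :=
    fun {n} hn ↦ WeierstrassCurve.card_torsionBy_eq_sq (E := V.baseChange (AlgebraicClosure L)) hn
  haveI hfin : Finite (WeierstrassCurve.geomTorsion V m) :=
    Nat.finite_of_card_ne_zero (by rw [hgeom hmK]; positivity)
  -- a geometric point `S₀` of order exactly `m`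
  obtain ⟨S₀, hS₀⟩ : ∃ S₀ : WeierstrassCurve.geomTorsion V m, addOrderOf S₀ = m := by
    have hexp : AddMonoid.ExponentExists (WeierstrassCurve.geomTorsion V m) := AddMonoid.ExponentExists.of_finite
    obtain ⟨S₀, hS₀⟩ := AddMonoid.exists_addOrderOf_eq_exponent hexp
    refine ⟨S₀, ?_⟩
    set N := AddMonoid.exponent (WeierstrassCurve.geomTorsion V m) with hN
    have hNm : N ∣ m :=
      AddMonoid.exponent_dvd_of_forall_nsmul_eq_zero fun S ↦ AddSubgroup.torsionBy.nsmul S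
    have hN0 : 0 < N := hexp.exponent_pos
    have hNK : (N : AlgebraicClosure L) ≠ 0 := by exact_mod_cast hN0.ne'
    haveI : Finite (WeierstrassCurve.geomTorsion V N) :=
      Nat.finite_of_card_ne_zero (by rw [hgeom hNK]; positivity)
    have hle : WeierstrassCurve.geomTorsion V m ≤ WeierstrassCurve.geomTorsion V N := by
      intro S hS
      have h := AddMonoid.exponent_nsmul_eq_zero (G := WeierstrassCurve.geomTorsion V m) ⟨S, hS⟩
      rw [← hN] at h
      exact AddSubgroup.torsionBy.nsmul_iff.mpr (by
        have := congrArg Subtype.val h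
        simpa using this)
    have hcardle := AddSubgroup.card_le_of_le hle
    rw [hgeom hmK, hgeom hNK] at hcardle
    have hmN : m ≤ N := by
      by_contra h
      push Not at h
      have : N ^ 2 < m ^ 2 := Nat.pow_lt_pow_left h two_ne_zero
      omega
    rw [hS₀]
    exact le_antisymm (Nat.le_of_dvd (by omega) hNm) hmN
  -- the character `T ↦ e(S₀, T)` with values in `L̄ˣ`
  have hunit : ∀ T, w S₀ T * w S₀ T ^ (m - 1) = 1 := fun T ↦ by
    rw [← pow_succ', Nat.sub_add_cancel (by omega), hpow]
  let u : WeierstrassCurve.geomTorsion V m → (AlgebraicClosure L)ˣ := fun T ↦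
    ⟨w S₀ T, w S₀ T ^ (m - 1), hunit T, by rw [mul_comm]; exact hunit T⟩
  let ψ : Multiplicative (WeierstrassCurve.geomTorsion V m) →* (AlgebraicClosure L)ˣ :=
    MonoidHom.mk' (fun T ↦ u T.toAdd) fun T₁ T₂ ↦ by
      ext
      simp only [u, toAdd_mul, Units.val_mul]
      exact haddr S₀ _ _
  haveI : Finite ψ.range := Finite.of_surjective ψ.rangeRestrict ψ.rangeRestrict_surjective
  haveI : IsCyclic ψ.range :=
    isCyclic_of_injective_ringHom ((Units.coeHom (AlgebraicClosure L)).comp ψ.range.subtype)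
      (Units.val_injective.comp Subtype.val_injective)
  obtain ⟨g, hg⟩ := IsCyclic.exists_ofOrder_eq_natCard (α := ψ.range)
  obtain ⟨T₁', hT₁⟩ := g.2
  set T₁ := T₁'.toAdd with hT₁def
  -- `#range` is a multiple of `m`
  have hd1 : ∀ T, w S₀ T ^ Nat.card ψ.range = 1 := fun T ↦ by
    have h := pow_card_eq_one' (G := ψ.range) (x := ⟨ψ (Multiplicative.ofAdd T), ⟨_, rfl⟩⟩)
    have h' := congrArg (fun z : ψ.range ↦ ((z : (AlgebraicClosure L)ˣ) : AlgebraicClosure L)) h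
    simp only [SubmonoidClass.coe_pow, Units.val_pow_eq_pow_val, OneMemClass.coe_one,
      Units.val_one] at h'
    exact h'
  have hmd : m ∣ Nat.card ψ.range := by
    have h : addOrderOf S₀ ∣ Nat.card ψ.range := by
      apply addOrderOf_dvd_of_nsmul_eq_zero
      apply hnd'
      intro T
      rw [hnsmul_left, hd1]
    rwa [hS₀] at h
  -- the generator is a value of the pairing of order `m`
  have hgval : ((g : (AlgebraicClosure L)ˣ) : AlgebraicClosure L) = w S₀ T₁ := by rw [← hT₁]; rfl
  refine ⟨S₀, T₁, hpow S₀ T₁, fun l hl ↦ hmd.trans ?_⟩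
  rw [← hg]
  apply orderOf_dvd_of_pow_eq_one
  apply Subtype.ext
  apply Units.ext
  rw [SubmonoidClass.coe_pow, Units.val_pow_eq_pow_val, hgval, hl, OneMemClass.coe_one, Units.val_one]

/-- **★ `μ_{p^{n+1}} ⊂ L(V[p^{n+1}])` in Galois form — the Weil-pairing containment, PROVED**: for `V` elliptic over a
field of characteristic `0` and `σ ∈ Gal(L̄/L(V[p^{n+1}]))` (`CM.torsionLayer V (p^(n+1))`, trivial on the `p^{n+1}`-torsion),
`χ_p(σ) ≡ 1 (mod p^{n+1})`: with `ζ = e(S₀, T₁)` a primitive `p^{n+1}`-th root of unity (`exists_weilPairing_isPrimitiveRoot`),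
`σ ζ = e(σ S₀, σ T₁) = ζ` (Galois equivariance) while `σ ζ = ζ^{χ_p(σ) mod p^{n+1}}` (`GaloisRep.cyclotomicCharacter_spec`).
[cite: SilvermanAEC2009, III §8 Prop. 8.1 and Cor. 8.1.1] -/
theorem dvd_cyclotomicCharacter_sub_one_of_mem_torsionLayer [CharZero L] [V.IsElliptic] (p : ℕ) [Fact p.Prime] (n : ℕ)
    (σ : absoluteGaloisGroup L) (hσ : σ ∈ CM.torsionLayer V (p ^ (n + 1))) :
    (p : ℤ_[p]) ^ (n + 1) ∣ ((GaloisRep.cyclotomicCharacter L p σ : ℤ_[p]ˣ) : ℤ_[p]) - 1 := by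
  have hp := (Fact.out : p.Prime)
  haveI : NeZero (p : L) := ⟨by exact_mod_cast hp.ne_zero⟩
  have hm : 2 ≤ p ^ (n + 1) := le_trans hp.two_le (Nat.le_self_pow (Nat.succ_ne_zero n) p)
  obtain ⟨e, hgal, S₀, T₁, hprim⟩ := exists_weilPairing_isPrimitiveRoot V hm
  -- `σ` fixes `V[p^{n+1}]` pointwise
  have hfix : ∀ Q : WeierstrassCurve.geomTorsion V ((p ^ (n + 1) : ℕ) : ℤ), σ • Q = Q := fun Q ↦ by
    have h1 := DFunLike.congr_fun (congrArg Multiplicative.toAdd (MonoidHom.mem_ker.mp hσ)) Q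
    rwa [WeierstrassCurve.galoisRepTorsion_apply] at h1
  -- hence `ζ = e(S₀, T₁)`: `ζ ^ (χ_p(σ) mod p^{n+1}) = σ ζ = ζ`
  set a : ℕ := ((GaloisRep.cyclotomicCharacter L p σ).val.toZModPow (n + 1)).val with ha
  have hζ : e S₀ T₁ ^ a = e S₀ T₁ ^ 1 := by
    rw [pow_one, ha, ← GaloisRep.cyclotomicCharacter_spec L p σ (e S₀ T₁) hprim.pow_eq_one, hgal, hfix, hfix]
  rw [(hprim.isOfFinOrder (by positivity)).pow_eq_pow_iff_modEq, ← hprim.eq_orderOf] at hζ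
  -- so `χ_p(σ) mod p^{n+1} = 1`
  have h1 : (GaloisRep.cyclotomicCharacter L p σ).val.toZModPow (n + 1) = 1 := by
    have h := (ZMod.natCast_eq_natCast_iff' a 1 (p ^ (n + 1))).mpr hζ
    rwa [ha, ZMod.natCast_zmod_val, Nat.cast_one] at h
  have hker : ((GaloisRep.cyclotomicCharacter L p σ : ℤ_[p]ˣ) : ℤ_[p]) - 1 ∈ RingHom.ker (PadicInt.toZModPow (n + 1)) := by
    rw [RingHom.mem_ker, map_sub, map_one, h1, sub_self]
  rwa [PadicInt.ker_toZModPow, Ideal.mem_span_singleton] at hker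

end Weil

/-! ## §4 ★ `isRayClassLayer_layer`, hypothesis-free -/

section RayClassLayer

variable {K : Type} [Field K] [NumberField K]

/-- **★ The cyclotomic layers `K_n` of a quadratic `K` are layers of the ray-class tower `K(V[7^∞·(7d)])/K` of every
elliptic curve `V/K`**: `CM.IsRayClassLayer V 7 (7·d) (Gal(K̄/K_n))`, i.e. `Gal(K̄/K_n)` is open and contains
`Gal(K̄/K(V[7^n·7d]))` — `K_n ⊂ K(μ_{7^{n+1}}) ⊂ K(V[7^{n+1}]) ⊂ K(V[7^n·7d])` (§2 + §3 + `torsionLayer_le_of_dvd`).  Inhabits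
the field `PinnedKatoGenusFrame.isRayClassLayer_layer` at `V = W.baseChange Φ.Kcm`, `d = F.d`, hypothesis-free.
[cite: Kato2004Asterisque, §15.1 (p. 250) and Prop. 15.9 (p. 258)] [cite: SilvermanAEC2009, III §8 Cor. 8.1.1] [cite: Washington1997, §13.1] -/
theorem isRayClassLayer_layer [Fact (Nat.Prime 7)] (h2 : Module.finrank ℚ K = 2) (κ : ZpExtension ℚ 7)
    (hκ : κ.IsCyclotomic) (V : WeierstrassCurve K) [V.IsElliptic] (d n : ℕ) :
    CM.IsRayClassLayer V 7 (7 * d) ((κ.restrictOfFinrankEqTwo (by decide) K h2).layerSubgroup n) := by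
  refine ⟨ZpExtension.isOpen_layerSubgroup _ n, n, fun σ hσ => ?_⟩
  have hσ' : σ ∈ CM.torsionLayer V (7 ^ (n + 1)) :=
    torsionLayer_le_of_dvd V (m := 7 ^ (n + 1)) (m' := 7 ^ n * (7 * d)) ⟨d, by ring⟩ hσ
  exact mem_layerSubgroup_restrict_of_dvd_cyclotomicCharacter_sub_one κ hκ (by norm_num) _ n σ
    (dvd_cyclotomicCharacter_sub_one_of_mem_torsionLayer V 7 n σ hσ')

/-- The same in the letter of the frame field: for the base change `W_K` of an elliptic curve over `ℚ`, every `n`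
(`(W.baseChange K).IsElliptic` from `W.IsElliptic` by Mathlib's `map` instance).
[cite: Kato2004Asterisque, Prop. 15.9 (p. 258)] [cite: SilvermanAEC2009, III §8 Cor. 8.1.1] -/
theorem isRayClassLayer_layer_baseChange [Fact (Nat.Prime 7)] (h2 : Module.finrank ℚ K = 2) (κ : ZpExtension ℚ 7)
    (hκ : κ.IsCyclotomic) (W : WeierstrassCurve ℚ) [W.IsElliptic] (d : ℕ) :
    ∀ n : ℕ, CM.IsRayClassLayer (W.baseChange K) 7 (7 * d) ((κ.restrictOfFinrankEqTwo (by decide) K h2).layerSubgroup n) := by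
  haveI : (W.baseChange K).IsElliptic := by
    rw [WeierstrassCurve.baseChange]
    infer_instance
  exact fun n => isRayClassLayer_layer h2 κ hκ (W.baseChange K) d n

end RayClassLayer

end NumberFieldColumn

end Summit.BirchSwinnertonDyer.Rank1Residual.Additive.GenusSeven

end
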